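import Literature.NumberTheory.Transcendental.AyoubPeriodSeriesPiAlgebraic
import Mathlib.Algebra.Order.Ring.Pow

/-!
# `StokesGeneration` (stmt-KontsevichZagierPeriods-3586), line `Sketch`, stub `stub_spanToReps` — part 3a:
coefficients of the type-(a) operator of `ℂ[[z₀, z₁, …]]`

Support file for the registered stub `stub_spanToReps` (dictionary, folding half) of the crux
`StokesGeneration` (route UnfoldedStokes, line `Sketch` = card cube-type-a-generation), on top of
`Literature/NumberTheory/Transcendental/AyoubPeriodSeries.lean` (`AyoubRel.CSeries = ℂ[[z₀, z₁, …]]`,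
`AyoubRel.pdz i = ∂/∂zᵢ`, `AyoubRel.restrC i c = (·)|_{zᵢ = c}`, `AyoubRel.relAC i = ∂/∂zᵢ − (·)|₁ + (·)|₀`,
`AyoubRel.DependsOnlyOnLT`).

* `∂ᵢ` and `(·)|_{zᵢ=c}` do not introduce variables (`dependsOnlyOnLT_pdz`,
  `dependsOnlyOnLT_restrC`; their `ℂ`-linearity is `AyoubRel.relAC_smul` of the tree);
* for `K` of polyradius `r > 1` the coefficients of `∂ᵢ K`, `K|_{zᵢ=c}` (`|c| ≤ 1`) and
  `∂ᵢK − K|₁ + K|₀` are absolutely summable (`summable_norm_coeff_pdz`: `(aᵢ + 1) ≤ |a + eᵢ| ≤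
  (r-1)⁻¹ r^{|a+eᵢ|}`; `summable_norm_coeff_restrC`: `Σₐ Σₙ ‖K_{a + n eᵢ}‖ = Σ_b ‖K_b‖` over
  `aᵢ = 0`; `summable_norm_coeff_relAC`).

This is coefficient bookkeeping for the folding half of the dictionary between Ayoub's series
`𝒪_{ℚ̄-alg}(𝔻̄^∞)` and real functions near the closed unit cube (J. Ayoub, EMS Newsl. 91 (2014) §2.2,
Def. 10, Rem. 13). No definition is introduced.
-/

noncomputable section

-- `Summit.KontsevichZagierPeriods.KontsevichZagierPeriods.…` is the tree's mandated layout (single-conjunct summit).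
set_option linter.dupNamespace false

namespace Summit.KontsevichZagierPeriods.KontsevichZagierPeriods.StokesGenerationLine

open Finsupp MvPowerSeries
open Literature.NumberTheory.Transcendental
open Literature.NumberTheory.Transcendental.AyoubRel

/-! ## Coefficients of `∂/∂zᵢ` and `(·)|_{zᵢ = c}`; linearity; variables -/

section Coeff

/-- `coeff_a (∂ᵢ F) = (aᵢ + 1) coeff_{a + eᵢ} F`. [cite: AyoubRelKZRevisited, Théorème 1.1 (a)] -/
theorem coeff_pdz (i : ℕ) (F : CSeries) (a : ℕ →₀ ℕ) :
    coeff a (pdz i F) = ((a i : ℂ) + 1) * coeff (a + single i 1) F := rfl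

/-- `coeff_a (F|_{zᵢ=c}) = [aᵢ = 0] Σₙ coeff_{a + n eᵢ} F cⁿ`. [cite: AyoubRelKZRevisited, Théorème 1.1 (a)] -/
theorem coeff_restrC (i : ℕ) (c : ℂ) (F : CSeries) (a : ℕ →₀ ℕ) :
    coeff a (restrC i c F) = if a i = 0 then ∑' n : ℕ, coeff (a + single i n) F * c ^ n else 0 :=
  rfl

/-- Coefficients of the type (a) operator. [cite: AyoubRelKZRevisited, Théorème 1.1 (a)] -/
theorem coeff_relAC (i : ℕ) (F : CSeries) (a : ℕ →₀ ℕ) :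
    coeff a (relAC i F) = coeff a (pdz i F) - coeff a (restrC i 1 F) + coeff a (restrC i 0 F) := by
  rw [relAC, map_add, map_sub]

variable {F : CSeries} {m : ℕ}

/-- `∂ᵢ` does not introduce variables. [folklore] -/
theorem dependsOnlyOnLT_pdz (i : ℕ) (h : DependsOnlyOnLT F m) : DependsOnlyOnLT (pdz i F) m := by
  rintro a ⟨i', hi', hai'⟩
  rw [coeff_pdz, h (a + single i 1) ⟨i', hi', fun h0 => hai' ?_⟩, mul_zero]
  rw [Finsupp.add_apply] at h0
  exact Nat.eq_zero_of_add_eq_zero_right h0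

/-- `(·)|_{zᵢ=c}` does not introduce variables. [folklore] -/
theorem dependsOnlyOnLT_restrC (i : ℕ) (c : ℂ) (h : DependsOnlyOnLT F m) :
    DependsOnlyOnLT (restrC i c F) m := by
  rintro a ⟨i', hi', hai'⟩
  rw [coeff_restrC]
  split_ifs with h0
  · have hn : ∀ n : ℕ, coeff (a + single i n) F * c ^ n = 0 := fun n => by
      rw [h (a + single i n) ⟨i', hi', fun h1 => hai' ?_⟩, zero_mul]
      rw [Finsupp.add_apply] at h1
      exact Nat.eq_zero_of_add_eq_zero_right h1
    simp only [hn, tsum_zero]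
  · rfl

end Coeff

/-! ## Absolute summability of the coefficients of `∂ᵢ K` and `K|_{zᵢ=c}` -/

section Summability

/-- `n ≤ (r - 1)⁻¹ rⁿ` for `r > 1` (Bernoulli). [folklore] -/
theorem nat_le_inv_mul_pow {r : ℝ} (hr : 1 < r) (n : ℕ) : (n : ℝ) ≤ (r - 1)⁻¹ * r ^ n := by
  have h := one_add_mul_le_pow (show (-2 : ℝ) ≤ r - 1 by linarith) n
  rw [add_sub_cancel] at h
  rw [le_inv_mul_iff₀ (sub_pos.mpr hr)]
  nlinarith

/-- **The coefficients of `∂ᵢ K` are absolutely summable** when `K` has polyradius `r > 1`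
(`(aᵢ + 1) ≤ |a + eᵢ| ≤ (r-1)⁻¹ r^{|a + eᵢ|}`). [folklore] -/
theorem summable_norm_coeff_pdz {F : CSeries} {r : ℝ} (hr : 1 < r)
    (hs : Summable fun b : ℕ →₀ ℕ => ‖coeff b F‖ * r ^ degree b) (i : ℕ) :
    Summable fun a : ℕ →₀ ℕ => ‖coeff a (pdz i F)‖ := by
  have hinj : Function.Injective fun a : ℕ →₀ ℕ => a + single i 1 := add_left_injective _
  have h1 : Summable ((fun b : ℕ →₀ ℕ => (r - 1)⁻¹ * (‖coeff b F‖ * r ^ degree b)) ∘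
      fun a : ℕ →₀ ℕ => a + single i 1) :=
    (hs.mul_left (r - 1)⁻¹).comp_injective hinj
  refine h1.of_nonneg_of_le (fun a => norm_nonneg _) fun a => ?_
  rw [Function.comp_apply, coeff_pdz, norm_mul]
  have hdeg : (a i : ℝ) + 1 ≤ ((degree (a + single i 1) : ℕ) : ℝ) := by
    have h : (a + single i 1 : ℕ →₀ ℕ) i ≤ degree (a + single i 1) := le_degree i (a + single i 1)
    rw [Finsupp.add_apply, single_eq_same] at h
    exact_mod_cast h
  have hn : ‖(a i : ℂ) + 1‖ = (a i : ℝ) + 1 := by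
    rw [show (a i : ℂ) + 1 = ((a i + 1 : ℕ) : ℂ) by push_cast; ring, Complex.norm_natCast]
    push_cast
    ring
  calc ‖(a i : ℂ) + 1‖ * ‖coeff (a + single i 1) F‖
      ≤ ((r - 1)⁻¹ * r ^ degree (a + single i 1)) * ‖coeff (a + single i 1) F‖ := by
        rw [hn]
        exact mul_le_mul_of_nonneg_right (hdeg.trans (nat_le_inv_mul_pow hr _)) (norm_nonneg _)
    _ = (r - 1)⁻¹ * (‖coeff (a + single i 1) F‖ * r ^ degree (a + single i 1)) := by ring

/-- **The coefficients of `K|_{zᵢ=c}` are absolutely summable** for `|c| ≤ 1` when those of `K`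
are (`Σₐ Σₙ ‖coeff_{a + n eᵢ} K‖ = Σ_b ‖coeff_b K‖` over `aᵢ = 0`). [folklore] -/
theorem summable_norm_coeff_restrC {F : CSeries} (hs : Summable fun b : ℕ →₀ ℕ => ‖coeff b F‖)
    (i : ℕ) {c : ℂ} (hc : ‖c‖ ≤ 1) :
    Summable fun a : ℕ →₀ ℕ => ‖coeff a (restrC i c F)‖ := by
  classical
  set g : (ℕ →₀ ℕ) → ℝ := fun b => ‖coeff b F‖ with hg
  set h : (ℕ →₀ ℕ) × ℕ → ℝ := fun p => if p.1 i = 0 then g (p.1 + single i p.2) else 0 with hh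
  set ψ : (ℕ →₀ ℕ) → (ℕ →₀ ℕ) × ℕ := fun b => (b.erase i, b i) with hψ
  have hψinj : Function.Injective ψ := by
    intro b b' e
    simp only [hψ, Prod.mk.injEq] at e
    rw [← erase_add_single i b, ← erase_add_single i b', e.1, e.2]
  have hψcomp : ∀ b, h (ψ b) = g b := by
    intro b
    simp only [hh, hψ, erase_same, if_true, erase_add_single]
  have hrange : ∀ p, p ∉ Set.range ψ → h p = 0 := by
    rintro ⟨a, n⟩ hp
    simp only [hh]
    split_ifs with ha
    · exact absurd ⟨a + single i n, by
        simp only [hψ, Prod.mk.injEq, erase_add_single_self, Finsupp.add_apply, single_eq_same,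
          ha, zero_add, and_true]
        exact erase_of_notMem_support (by simpa using ha)⟩ hp
    · rfl
  have hhs : Summable h := by
    refine (hψinj.summable_iff hrange).mp ?_
    have : h ∘ ψ = g := funext hψcomp
    rw [this]
    exact hs
  have hh0 : ∀ p, 0 ≤ h p := fun p => by
    simp only [hh]
    split_ifs
    · exact norm_nonneg _
    · exact le_rfl
  refine (hhs.prod).of_nonneg_of_le (fun a => norm_nonneg _) fun a => ?_
  rw [coeff_restrC]
  split_ifs with ha
  · have hsum_n : Summable fun n => h (a, n) := hhs.prod_factor a
    have hle : ∀ n, ‖coeff (a + single i n) F * c ^ n‖ ≤ h (a, n) := fun n => by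
      simp only [hh, if_pos ha, hg, norm_mul, norm_pow]
      exact mul_le_of_le_one_right (norm_nonneg _) (pow_le_one₀ (norm_nonneg _) hc)
    have hsn : Summable fun n => ‖coeff (a + single i n) F * c ^ n‖ :=
      Summable.of_nonneg_of_le (fun _ => norm_nonneg _) hle hsum_n
    exact (norm_tsum_le_tsum_norm hsn).trans (Summable.tsum_le_tsum hle hsn hsum_n)
  · rw [norm_zero]
    exact tsum_nonneg fun n => hh0 _

/-- Coefficients of a scalar multiple are absolutely summable. [folklore] -/
theorem summable_norm_coeff_smul {F : CSeries} (hs : Summable fun b : ℕ →₀ ℕ => ‖coeff b F‖)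
    (c : ℂ) : Summable fun b : ℕ →₀ ℕ => ‖coeff b (c • F)‖ := by
  refine (hs.mul_left ‖c‖).congr fun b => ?_
  rw [coeff_smul, norm_mul]

/-- Weighted coefficients of a scalar multiple are summable. [folklore] -/
theorem summable_norm_coeff_smul_weighted {F : CSeries} {r : ℝ}
    (hs : Summable fun b : ℕ →₀ ℕ => ‖coeff b F‖ * r ^ degree b) (c : ℂ) :
    Summable fun b : ℕ →₀ ℕ => ‖coeff b (c • F)‖ * r ^ degree b := by
  refine (hs.mul_left ‖c‖).congr fun b => ?_
  rw [coeff_smul, norm_mul, mul_assoc]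

/-- The coefficients of the type (a) image `∂ᵢK − K|₁ + K|₀` are absolutely summable when `K` has
polyradius `r > 1`. [folklore] -/
theorem summable_norm_coeff_relAC {F : CSeries} {r : ℝ} (hr : 1 < r)
    (hs : Summable fun b : ℕ →₀ ℕ => ‖coeff b F‖ * r ^ degree b) (i : ℕ) :
    Summable fun a : ℕ →₀ ℕ => ‖coeff a (relAC i F)‖ := by
  have h0 := summable_norm_coeff_of_hasPolyradiusGtOne ⟨r, hr, hs⟩
  have h1 := summable_norm_coeff_pdz hr hs i
  have h2 := summable_norm_coeff_restrC h0 i (c := 1) (by simp)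
  have h3 := summable_norm_coeff_restrC h0 i (c := 0) (by simp)
  refine ((h1.add h2).add h3).of_nonneg_of_le (fun _ => norm_nonneg _) fun a => ?_
  rw [coeff_relAC]
  exact (norm_add_le _ _).trans (add_le_add (norm_sub_le _ _) le_rfl)

end Summability

/-! ## Registered form -/

/-- **Registered auxiliary stub** `stub_spanToRepsAuxCoeff` (sub-goal of `stub_spanToReps`, crux
stmt-KontsevichZagierPeriods-3586): for `K ∈ ℂ[[z₀, z₁, …]]` of polyradius `r > 1` the coefficients of
the type (a) image `∂ᵢK − K|_{zᵢ=1} + K|_{zᵢ=0}` are absolutely summable, and the type (a) operator is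
`ℂ`-linear (= `summable_norm_coeff_relAC`, and the tree's `AyoubRel.relAC_smul`).
[cite: AyoubRelKZRevisited, Théorème 1.1 (a)] -/
theorem stub_spanToRepsAuxCoeff :
    ∀ (K : MvPowerSeries ℕ ℂ) (r : ℝ) (i : ℕ) (c : ℂ), 1 < r →
      Summable (fun b : ℕ →₀ ℕ => ‖MvPowerSeries.coeff b K‖ * r ^ b.degree) →
      Summable (fun a : ℕ →₀ ℕ => ‖MvPowerSeries.coeff a (AyoubRel.relAC i K)‖) ∧
        AyoubRel.relAC i (c • K) = c • AyoubRel.relAC i K :=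
  fun K _ i c hr hs => ⟨summable_norm_coeff_relAC hr hs i, relAC_smul i c K⟩

end Summit.KontsevichZagierPeriods.KontsevichZagierPeriods.StokesGenerationLine
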